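import Mathlib
import HarnessLib
import Summits.ABC.ABC.Theses.LogCardinality
import Literature.Barriers.ABC.EpsilonCannotBeDroppedProofs

/-!
# Per-piece birth skeletons for the two children of the regime split of `BakerRefinement` (stmt-ABC-1756)

Ready for the day `ledger route edit --split BakerRefinement --into children.json` (DECOMPOSITION.md §5) installs
`FewPrimesBaker` and `ManyPrimesSubexp` as route decls: then replace the scratch namespace
`Summit.ABC.ABC.Cruxes.BakerRefinement.RegimeSplit.Pieces` below by `Summit.ABC.ABC.Theses.LogCardinality` (delete §0),
split this file in two and register each with `ledger skeleton check … --crux <child item>`.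
§1 FewPrimesBaker: 2 stubs (`stub_fixedOmega`, `stub_tailUniform`) + `FewPrimesBaker_of`. §2 ManyPrimesSubexp: 1 stub
(`stub_rstManyPrimes`) + the cited comparison `rstExponent_le_sqrt_log` + `ManyPrimesSubexp_of` — piece 2 is one
statement deep (RST (1.5) restricted); no second stub is pretended. Sorries only in the three stubs.
-/

set_option linter.dupNamespace false

/-! ## §0 The pieces (scratch copies of the children statements, verbatim) -/

namespace Summit.ABC.ABC.Cruxes.BakerRefinement.RegimeSplit.Pieces

/-- crux (rank 2) · FEW PRIMES. Baker's refinement on the abc triples (`a < b`) with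
`ω(abc)² < log rad(abc)`: `c < κ·N·(log N)^ω/ω!` — a UNIFORM bound for `S`-unit equations in few
primes (polynomial in `log N` for bounded `ω`); the part of Baker's conjecture that no abc-type
conjecture with a sub-exponential error term implies. -/
def FewPrimesBaker : Prop :=
  ∃ κ : ℝ, ∀ a b c : ℕ, Literature.NumberTheory.DiophantineGeometry.IsABCTriple a b c → a < b →
    ((ArithmeticFunction.cardDistinctFactors (a * b * c) : ℕ) : ℝ) ^ 2 <
        Real.log (Literature.NumberTheory.DiophantineGeometry.rad a b c : ℕ) →
      (c : ℝ) < κ * (Literature.NumberTheory.DiophantineGeometry.rad a b c : ℝ) *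
        Real.log (Literature.NumberTheory.DiophantineGeometry.rad a b c : ℕ) ^
          (ArithmeticFunction.cardDistinctFactors (a * b * c)) /
        (Nat.factorial (ArithmeticFunction.cardDistinctFactors (a * b * c)) : ℝ)

/-- crux (rank 3) · MANY PRIMES. An abc inequality at the Stewart–Tijdeman scale on the abc triples
(`a < b`) with `log rad(abc) ≤ ω(abc)²`: `c < κ·N·exp(A·√(log N))` for some `κ, A` — implied by
Robert–Stewart–Tenenbaum's Conjecture A (1.5) restricted to this regime; not a restriction of Baker's
bound. -/
def ManyPrimesSubexp : Prop :=
  ∃ κ A : ℝ, ∀ a b c : ℕ, Literature.NumberTheory.DiophantineGeometry.IsABCTriple a b c → a < b →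
    Real.log (Literature.NumberTheory.DiophantineGeometry.rad a b c : ℕ) ≤
        ((ArithmeticFunction.cardDistinctFactors (a * b * c) : ℕ) : ℝ) ^ 2 →
      (c : ℝ) < κ * (Literature.NumberTheory.DiophantineGeometry.rad a b c : ℝ) *
        Real.exp (A * Real.sqrt (Real.log (Literature.NumberTheory.DiophantineGeometry.rad a b c : ℕ)))

end Summit.ABC.ABC.Cruxes.BakerRefinement.RegimeSplit.Pieces

/-! ## §1 FewPrimesBaker -/

namespace Summit.ABC.ABC.Cruxes.FewPrimesBaker.Birth

open Literature.NumberTheory.DiophantineGeometry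
open Summit.ABC.ABC.Cruxes.BakerRefinement.RegimeSplit.Pieces

/-! ## The two registered OPEN stubs -/

/-- **Stub 1 (one `ω` at a time): the uniform few-primes `S`-unit bound with an `ω`-dependent constant.**
For every `t` there is `κ_t` with `c < κ_t·N·(log N)^t/t!` for all abc triples (`a < b`) with `ω(abc) = t`
and `t² < log N`. Vacuous for `t ≤ 1`, provable for `t = 2` (`κ₂ = 1`), OPEN from `t = 3` on (stronger than
abc for these triples: polynomial in `log N`). Sources: Baker2004 §3 Conj. 4; LaishramShorey2012 Thm 1;
EvertseGyory2015 Ch. 4–6 (effective S-unit bounds are exponential in the primes). -/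
theorem stub_fixedOmega :
    ∀ t : ℕ, ∃ κ : ℝ, ∀ a b c : ℕ, IsABCTriple a b c → a < b →
      ArithmeticFunction.cardDistinctFactors (a * b * c) = t →
        ((t : ℕ) : ℝ) ^ 2 < Real.log (rad a b c : ℕ) →
          (c : ℝ) < κ * (rad a b c : ℝ) * Real.log (rad a b c : ℕ) ^ t / (Nat.factorial t : ℝ) := by
  sorry

/-- **Stub 2 (uniformity in `ω` beyond a threshold).** There are `T` and ONE `κ` with
`c < κ·N·(log N)^ω/ω!` for all abc triples (`a < b`) with `T ≤ ω(abc)` and `ω(abc)² < log N`. OPEN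
(Baker's calibration `κ ≈ 1.2` on the 196 extremal triples, all with `ω ≥ 4`, Baker2004 §4; RST2014 §1
heuristic pressure at `ω ≍ √(log N)/(log₂N)^{3/2}`). -/
theorem stub_tailUniform :
    ∃ T : ℕ, ∃ κ : ℝ, ∀ a b c : ℕ, IsABCTriple a b c → a < b →
      T ≤ ArithmeticFunction.cardDistinctFactors (a * b * c) →
        ((ArithmeticFunction.cardDistinctFactors (a * b * c) : ℕ) : ℝ) ^ 2 < Real.log (rad a b c : ℕ) →
          (c : ℝ) < κ * (rad a b c : ℝ) *
            Real.log (rad a b c : ℕ) ^ (ArithmeticFunction.cardDistinctFactors (a * b * c)) /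
            (Nat.factorial (ArithmeticFunction.cardDistinctFactors (a * b * c)) : ℝ) := by
  sorry

/-! ## The composition: the crux BY NAME from the two stubs -/

/-- `stub_fixedOmega → stub_tailUniform → FewPrimesBaker`: take `T, κ_T` from the tail and
`κ := max κ_T 0 + Σ_{t<T} max κ_t 0`. [folklore] -/
theorem FewPrimesBaker_of :
    (∀ t : ℕ, ∃ κ : ℝ, ∀ a b c : ℕ, IsABCTriple a b c → a < b →
      ArithmeticFunction.cardDistinctFactors (a * b * c) = t →
        ((t : ℕ) : ℝ) ^ 2 < Real.log (rad a b c : ℕ) →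
          (c : ℝ) < κ * (rad a b c : ℝ) * Real.log (rad a b c : ℕ) ^ t / (Nat.factorial t : ℝ)) →
    (∃ T : ℕ, ∃ κ : ℝ, ∀ a b c : ℕ, IsABCTriple a b c → a < b →
      T ≤ ArithmeticFunction.cardDistinctFactors (a * b * c) →
        ((ArithmeticFunction.cardDistinctFactors (a * b * c) : ℕ) : ℝ) ^ 2 < Real.log (rad a b c : ℕ) →
          (c : ℝ) < κ * (rad a b c : ℝ) *
            Real.log (rad a b c : ℕ) ^ (ArithmeticFunction.cardDistinctFactors (a * b * c)) /
            (Nat.factorial (ArithmeticFunction.cardDistinctFactors (a * b * c)) : ℝ)) →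
    FewPrimesBaker := by
  intro h1 h2
  obtain ⟨T, κT, hT⟩ := h2
  choose κf hκf using h1
  refine ⟨max κT 0 + ∑ t ∈ Finset.range T, max (κf t) 0, fun a b c ht hab hfew => ?_⟩
  set ω := ArithmeticFunction.cardDistinctFactors (a * b * c) with hω
  set L := Real.log (rad a b c : ℕ) with hL
  have hN0 : (0 : ℝ) < (rad a b c : ℝ) := by
    have := ht.two_le_rad; exact_mod_cast (by omega : 0 < rad a b c)
  have hL0 : 0 ≤ L := Real.log_nonneg (by have := ht.two_le_rad; exact_mod_cast (by omega : 1 ≤ rad a b c))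
  have hB0 : (0 : ℝ) ≤ (rad a b c : ℝ) * L ^ ω / (Nat.factorial ω : ℝ) := by positivity
  have hsum0 : 0 ≤ ∑ t ∈ Finset.range T, max (κf t) 0 :=
    Finset.sum_nonneg fun t _ => le_max_right _ _
  have mono : ∀ κ κ' : ℝ, κ ≤ κ' →
      κ * (rad a b c : ℝ) * L ^ ω / (Nat.factorial ω : ℝ) ≤
        κ' * (rad a b c : ℝ) * L ^ ω / (Nat.factorial ω : ℝ) := by
    intro κ κ' h
    have e1 : κ * (rad a b c : ℝ) * L ^ ω / (Nat.factorial ω : ℝ) =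
        κ * ((rad a b c : ℝ) * L ^ ω / (Nat.factorial ω : ℝ)) := by ring
    have e2 : κ' * (rad a b c : ℝ) * L ^ ω / (Nat.factorial ω : ℝ) =
        κ' * ((rad a b c : ℝ) * L ^ ω / (Nat.factorial ω : ℝ)) := by ring
    rw [e1, e2]
    exact mul_le_mul_of_nonneg_right h hB0
  rcases lt_or_ge ω T with hlt | hge
  · -- finitely many `ω < T`: the `ω`-th constant of the family
    have hc := hκf ω a b c ht hab rfl hfew
    have hκ : κf ω ≤ max κT 0 + ∑ t ∈ Finset.range T, max (κf t) 0 := by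
      have h1 : max (κf ω) 0 ≤ ∑ t ∈ Finset.range T, max (κf t) 0 :=
        Finset.single_le_sum (f := fun t => max (κf t) 0) (fun i _ => le_max_right _ _)
          (Finset.mem_range.mpr hlt)
      have h2 := le_max_left (κf ω) 0
      have h3 := le_max_right κT 0
      linarith
    exact lt_of_lt_of_le hc (mono _ _ hκ)
  · -- the tail `T ≤ ω`
    have hc := hT a b c ht hab hge hfew
    have hκ : κT ≤ max κT 0 + ∑ t ∈ Finset.range T, max (κf t) 0 := by
      have := le_max_left κT 0; linarith
    exact lt_of_lt_of_le hc (mono _ _ hκ)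

/-- Skeleton convention: the piece BY NAME from the declared stubs. [folklore] -/
theorem FewPrimesBaker_holds_of_stubs : FewPrimesBaker := FewPrimesBaker_of stub_fixedOmega stub_tailUniform

end Summit.ABC.ABC.Cruxes.FewPrimesBaker.Birth

/-! ## §2 ManyPrimesSubexp -/

namespace Summit.ABC.ABC.Cruxes.ManyPrimesSubexp.Birth

open Literature.NumberTheory.DiophantineGeometry
open Literature.Barriers.ABC
open Summit.ABC.ABC.Cruxes.BakerRefinement.RegimeSplit.Pieces

/-! ## The registered stub and the cited comparison -/

/-- **Stub 1 (OPEN): RST Conjecture A (1.5) on the many-primes regime.** There is `C₁` with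
`c < k·exp(4√(3 log k/log₂k)(1 + log₃k/(2log₂k) + C₁/log₂k))`, `k = rad(abc)`, for every abc triple
(`a < b`) with `log k ≤ ω(abc)²`. [cite: RobertStewartTenenbaum2014, Conjecture A (1.5)] restricted;
weaker than `RSTConjectureAUpper` (which implies `ABC`). -/
theorem stub_rstManyPrimes :
    ∃ C₁ : ℝ, ∀ a b c : ℕ, IsABCTriple a b c → a < b →
      Real.log (rad a b c : ℕ) ≤ ((ArithmeticFunction.cardDistinctFactors (a * b * c) : ℕ) : ℝ) ^ 2 →
        (c : ℝ) < (rad a b c : ℝ) * Real.exp (rstExponent C₁ (rad a b c : ℕ)) := by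
  sorry

/-- (cited lemma, not a stub) `rstExponent C₁ k ≤ A·√(log k)` for `k ≥ 2`, from the landed
`Literature.Barriers.ABC.rstExponent_le`. [folklore] -/
theorem rstExponent_le_sqrt_log :
    ∀ C₁ : ℝ, ∃ A : ℝ, 0 ≤ A ∧ ∀ k : ℕ, 2 ≤ k → rstExponent C₁ k ≤ A * Real.sqrt (Real.log k) := by
  intro C₁
  refine ⟨4 * Real.sqrt 3 * (3 / 2 + |C₁|), by positivity, fun k hk => ?_⟩
  exact rstExponent_le C₁ (by exact_mod_cast le_trans one_le_two hk)

/-! ## The composition: the crux BY NAME from the two stubs -/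

/-- `stub_rstManyPrimes → stub_rstExponent_le → ManyPrimesSubexp` (`κ = 1`). [folklore] -/
theorem ManyPrimesSubexp_of :
    (∃ C₁ : ℝ, ∀ a b c : ℕ, IsABCTriple a b c → a < b →
      Real.log (rad a b c : ℕ) ≤ ((ArithmeticFunction.cardDistinctFactors (a * b * c) : ℕ) : ℝ) ^ 2 →
        (c : ℝ) < (rad a b c : ℝ) * Real.exp (rstExponent C₁ (rad a b c : ℕ))) →
    (∀ C₁ : ℝ, ∃ A : ℝ, 0 ≤ A ∧ ∀ k : ℕ, 2 ≤ k → rstExponent C₁ k ≤ A * Real.sqrt (Real.log k)) →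
    ManyPrimesSubexp := by
  rintro ⟨C₁, h₁⟩ h₂
  obtain ⟨A, hA0, hA⟩ := h₂ C₁
  refine ⟨1, A, fun a b c ht hab hmany => ?_⟩
  have hc := h₁ a b c ht hab hmany
  have hk : 2 ≤ rad a b c := ht.two_le_rad
  have hN0 : (0 : ℝ) ≤ (rad a b c : ℝ) := by positivity
  have hexp : Real.exp (rstExponent C₁ (rad a b c : ℕ)) ≤
      Real.exp (A * Real.sqrt (Real.log (rad a b c : ℕ))) :=
    Real.exp_le_exp.mpr (hA _ hk)
  calc (c : ℝ) < (rad a b c : ℝ) * Real.exp (rstExponent C₁ (rad a b c : ℕ)) := hc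
    _ ≤ (rad a b c : ℝ) * Real.exp (A * Real.sqrt (Real.log (rad a b c : ℕ))) :=
        mul_le_mul_of_nonneg_left hexp hN0
    _ = 1 * (rad a b c : ℝ) * Real.exp (A * Real.sqrt (Real.log (rad a b c : ℕ))) := by ring

/-- Skeleton convention: the piece BY NAME from the declared stub and the cited lemma. [folklore] -/
theorem ManyPrimesSubexp_holds_of_stubs : ManyPrimesSubexp :=
  ManyPrimesSubexp_of stub_rstManyPrimes rstExponent_le_sqrt_log

end Summit.ABC.ABC.Cruxes.ManyPrimesSubexp.Birth
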